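import Mathlib.Algebra.Group.Submonoid.Membership
import Mathlib.Algebra.Group.Subgroup.Basic
import Mathlib.Algebra.Group.End
import Mathlib.GroupTheory.Torsion
import Mathlib.Algebra.Category.Grp.Basic
import Literature.IUT.HodgeArakelov.BadPrimeGaussianMonoids

/-!
# [IUTchII] §3, Propositions 3.1, 3.3, 3.4, Example 3.2, Corollary 3.7, Definition 3.8:
# theta monoids and constant monoids at bad primes (mono-theta-theoretic, Frobenioid-theoretic,
# group-theoretic), their multi- and uni-radiality, and the associated Frobenioids

S. Mochizuki, *Inter-universal Teichmüller theory II*, §3 "Tempered Gaussian Frobenioids"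
(kurims Dec-2020 manuscript): Proposition 3.1 (pp. 87–88), Example 3.2 (pp. 88–89),
Proposition 3.3 (pp. 89–90), Proposition 3.4 (pp. 91–93), Remark 3.4.1 (p. 93), Corollary 3.7
(pp. 110–112), Remark 3.7.1 (p. 112), Definition 3.8 (pp. 112–115), Remark 3.8.1 (p. 115)
[cite: Mochizuki2012, Prop 3.1 p.87]. Claim key DISPUTED (D-0012): definitions, interfaces and
Prop-valued statements only; nothing here asserts a disputed claim.

**What is printed.** (3.1 (i)) a functorial algorithm `M^Θ_* ↦ {M^×_TM(M^Θ_*), θ^ι_env(M^Θ_*),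
∞θ^ι_env(M^Θ_*), M^×_TM·∞θ^ι_env(M^Θ_*) ⊆ lim_J H¹(Π_Ÿ(M^Θ_*)|_J, Π_μ(M^Θ_*))}_ι` with conjugation action
by `Π_X(M^Θ_*)`, and "the submonoids `Ψ^ι_env(M^Θ_*) = M^×_TM(M^Θ_*)·θ^ι_env(M^Θ_*)^ℕ`,
`∞Ψ^ι_env(M^Θ_*) = M^×_TM(M^Θ_*)·∞θ^ι_env(M^Θ_*)^ℕ` … generated, respectively, by the subsets
`M^×_TM·θ^ι_env`, `M^×_TM·∞θ^ι_env`", with "splittings up to torsion" — the **theta monoids**;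
(3.1 (ii)) the **constant monoid** `Ψ_cns(M^Θ_*) := M_TM(M^Θ_*)` "naturally isomorphic to `O^▷_{F̄_v}`".
(Ex 3.2 (i)) from a tempered Frobenioid `F_v` and a Frobenioid-theoretic theta function
`Θ_v ∈ O^×(T^÷_{Ÿ_v})`: `Ψ_{F^Θ_v,id} := O^×_{C^Θ_v}(A^Θ_∞)·Θ_v^ℕ|_{A^Θ_∞} ⊆ ∞Ψ_{F^Θ_v,id} := O^×·Θ_v^{ℚ≥0}
⊆ O^×(T^÷_{A^Θ_∞})`, the conjugates `Ψ_{F^Θ_v,α}`, `α ∈ Π_v`, "characteristic splittings up to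
torsion", reconstructible "category-theoretically from `F_v` … up to an indeterminacy arising
from the inner automorphisms of `Π_v`"; (Ex 3.2 (ii)) `Ψ_{C_v} := O^▷_{C_v}(A^Θ_∞)` with `Π_v`-action.
(3.3 (i)–(ii)) Kummer isomorphisms `Ψ_{†F^Θ_v,α} ⥲ Ψ^ι_env(M^Θ_*)`, `∞Ψ_{†F^Θ_v,α} ⥲ ∞Ψ^ι_env(M^Θ_*)` "for a
suitable bijection of `l·ℤ`-torsors" between the `ι`'s and the `α`'s, and `Ψ_{†C_v} ⥲ Ψ_cns(M^Θ_*)`,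
each "well-defined up to composition with an inner automorphism". (3.4 (i)) multiradiality of
split theta monoids; (3.4 (ii)) uniradiality of constant monoids; (3.7 (i)–(ii)) from
group-theoretic to post-anabelian Gaussian monoids; uniradiality of Gaussian monoids.
(Def 3.8 (i)–(iii)) the `p_v`-adic Frobenioids of monoid type `ℤ` attached to these monoids,
`F_cns(M^Θ_*)`, `F_{†C_v}`, `F^ι_env(M^Θ_*)`, `F_{†F^Θ_v,α}`, `F_ξ(M^Θ_*)`, `F_{F_ξ}(†F_v)`, the tautological
and Kummer isomorphisms of (split) Frobenioids, the subcategories `F_{2l·ξ} ⊆ F_ξ`, the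
"Gaussian distribution" embeddings `F_gau(M^Θ_*) ↪ F^⊢_cns(M^Θ_*)_{F_l^⋇} := ∏_{|t|} F^⊢_cns(M^Θ_*)_{|t|}` and
the diagonal "constant distributions".

**Dictionary.** The ambient modules (`lim_J H¹(…)`, `O^×(T^÷_{A^Θ_∞})`) are abstract commutative
groups written multiplicatively; a conjugation action of a (topological) group is
`ρ : P →* MulAut H` (topologies suppressed). `M^×_TM` / `O^×_{C^Θ_v}(A^Θ_∞)` is a subgroup `units`;
`θ^ι_env`, `∞θ^ι_env` (resp. `Θ_v`) are INPUT subsets/elements (outputs of Prop 1.5, Cor 2.8 /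
[IUTchI] Ex 3.2 — owners abc-iut-L6-t1 / abc-iut-L5-t2). Over these the theta monoids are REAL
submonoids (`thetaMonoid`, `inftyThetaMonoid`, `frobThetaMonoid`, `inftyFrobThetaMonoid`), and
"splitting up to torsion" is the REAL predicate `IsSplittingUpToTorsion`. The reconstruction,
Kummer-comparison and radiality sentences, whose inputs (mono-theta environments, tempered
Frobenioids, the radial environments of Example 1.7, `Ism` of Example 1.8 (iv)) are not in the
tree, are Prop-valued fields of interface structures quoting print
(`Prop33KummerStatements`, `RadialityStatements`, `Def38Frobenioids`).
v2: all declarations in the sub-namespace `Literature.IUT.HodgeArakelov.TemperedThetaMonoids`; `Θ^{ℚ≥0}`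
is the tree's `rootPowers` (BadPrimeGaussianMonoids, both exponents positive).
-- TODO-merge: abc-iut-L6-t1 (Props 1.2–1.5, Ex 1.7, 1.8, Cors 1.12, 2.8, 2.9), abc-iut-L5-t2
-- ([IUTchI] Ex 3.2, Def 3.6), abc-iut-L2-t2/t4 ([EtTh] mono-theta environments), abc-iut-L1-t4
-- ([FrdII] Ex 1.1 (ii) `p_v`-adic Frobenioids of monoid type `ℤ`).
-/

namespace Literature.IUT.HodgeArakelov

/-! All declarations of this file live in the sub-namespace `TemperedThetaMonoids` (review q9917164
item 2: the bare name `ThetaEnvData` is booked by abc-iut-L6-t1's PRODUCER structure). -/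
namespace TemperedThetaMonoids

universe u v w

/-! ### 1. Splittings up to torsion (used in 3.1 (i), 3.2 (i), 3.3 (i)) -/

section Splitting

variable {H : Type u} [CommGroup H]

/-- A pair of submonoids `(U, S)` of a commutative group is a **splitting up to torsion** of the
submonoid `U ⊔ S` when `U` is a subgroup containing all the units involved and `U ∩ S` consists of
torsion elements ("splittings up to torsion determined by the subsets `M^×_TM(M^Θ_*)`,
`θ^ι_env(M^Θ_*)`", [IUTchII] Prop 3.1 (i) p. 87; "characteristic splittings, up to torsion" [IUTchI]
Ex 3.2 (v), [IUTchII] Ex 3.2 (i) p. 89). [cite: Mochizuki2012, Prop 3.1 (i) p.87] -/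
structure IsSplittingUpToTorsion (U : Subgroup H) (S : Submonoid H) : Prop where
  /-- elements common to the unit part and the "value" part are torsion -/
  inter_torsion : ∀ x : H, x ∈ U → x ∈ S → IsOfFinOrder x

/-- The submonoid presented by a splitting: `U · S` ("`M^×_TM · θ^ℕ`").
[cite: Mochizuki2012, Prop 3.1 (i) p.87] -/
def splitMonoid (U : Subgroup H) (S : Submonoid H) : Submonoid H := U.toSubmonoid ⊔ S

/-- Every element of `U · S` is a product `u · s` ([IUTchII] Prop 3.1 (i) p. 87 notation
"`M^×_TM(M^Θ_*) · θ^ι_env(M^Θ_*)^ℕ`"). [cite: Mochizuki2012, Prop 3.1 (i) p.87] -/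
theorem mem_splitMonoid_iff (U : Subgroup H) (S : Submonoid H) (x : H) :
    x ∈ splitMonoid U S ↔ ∃ u ∈ U, ∃ s ∈ S, u * s = x := by
  unfold splitMonoid
  rw [Submonoid.mem_sup]
  simp only [Subgroup.mem_toSubmonoid]

end Splitting

/-! ### 2. Proposition 3.1: mono-theta-theoretic theta and constant monoids (pp. 87–88) -/

/-- INPUT DATA of Proposition 3.1 (the OUTPUT of "the constructions of Proposition 1.5 (iii);
Corollary 2.8 (i)" applied to a projective system of mono-theta environments `M^Θ_*` with
`Π_X(M^Θ_*) ≅ Π_v`, p. 87): the ambient module `lim_J H¹(Π_Ÿ(M^Θ_*)|_J, Π_μ(M^Θ_*))` with the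
conjugation action of `Π_X(M^Θ_*)`, the unit subgroup `M^×_TM(M^Θ_*)`, the monoid `M_TM(M^Θ_*)`, and
for each inversion automorphism `ι` (Prop 2.2 (i)) the subsets `θ^ι_env`, `∞θ^ι_env`.
-- TODO-merge: abc-iut-L6-t1 (Prop 1.5 (iii), Prop 2.2 (i), Cor 2.8 (i), Cor 1.12 (d)).
[cite: Mochizuki2012, Prop 3.1 p.87] -/
structure ThetaEnvData (P : Type u) [Group P] where
  /-- the ambient module `lim_J H¹(Π_Ÿ|_J, Π_μ)` (multiplicative notation; bundled `CommGrpCat`) -/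
  H : CommGrpCat.{v}
  /-- the conjugation action of `Π_X(M^Θ_*)` -/
  conj : P →* MulAut H
  /-- the index set of inversion automorphisms `ι` (Prop 2.2 (i)) -/
  Iota : Type v
  /-- `M^×_TM(M^Θ_*)` -/
  units : Subgroup H
  /-- `M_TM(M^Θ_*) ⊇ M^×_TM(M^Θ_*)`, the constant monoid of (ii) -/
  constants : Submonoid H
  /-- `M^×_TM` is the group of units of `M_TM` -/
  units_eq : ∀ x : H, x ∈ units ↔ (x ∈ constants ∧ x⁻¹ ∈ constants)
  /-- `θ^ι_env(M^Θ_*)` -/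
  thetaEnv : Iota → Set H
  /-- `∞θ^ι_env(M^Θ_*) ⊇ θ^ι_env(M^Θ_*)` (the `N`-th roots, all `N`) -/
  inftyThetaEnv : Iota → Set H
  /-- `θ^ι_env ⊆ ∞θ^ι_env` -/
  theta_subset : ∀ ι, thetaEnv ι ⊆ inftyThetaEnv ι


namespace ThetaEnvData

variable {P : Type u} [Group P] (E : ThetaEnvData.{u, v} P)

/-- `Ψ^ι_env(M^Θ_*) := M^×_TM(M^Θ_*) · θ^ι_env(M^Θ_*)^ℕ`, a **theta monoid** ([IUTchII] Prop 3.1 (i) p. 87: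
"the submonoids … generated … by the subsets `M^×_TM · θ^ι_env(M^Θ_*)`").
[cite: Mochizuki2012, Prop 3.1 (i) p.87] -/
def thetaMonoid (ι : E.Iota) : Submonoid E.H := splitMonoid E.units (Submonoid.closure (E.thetaEnv ι))

/-- `∞Ψ^ι_env(M^Θ_*) := M^×_TM(M^Θ_*) · ∞θ^ι_env(M^Θ_*)^ℕ` ([IUTchII] Prop 3.1 (i) p. 87).
[cite: Mochizuki2012, Prop 3.1 (i) p.87] -/
def inftyThetaMonoid (ι : E.Iota) : Submonoid E.H :=
  splitMonoid E.units (Submonoid.closure (E.inftyThetaEnv ι))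

/-- `Ψ^ι_env ⊆ ∞Ψ^ι_env` (the "`∪`" of the displays on p. 91).
[cite: Mochizuki2012, Prop 3.1 (i) p.87] -/
theorem thetaMonoid_le_infty (ι : E.Iota) : E.thetaMonoid ι ≤ E.inftyThetaMonoid ι :=
  sup_le_sup_left (Submonoid.closure_mono (E.theta_subset ι)) _

/-- `Ψ_env(M^Θ_*) := {Ψ^ι_env(M^Θ_*)}_ι`, `∞Ψ_env(M^Θ_*) := {∞Ψ^ι_env(M^Θ_*)}_ι` ([IUTchII] Prop 3.1 (i)
p. 87). [cite: Mochizuki2012, Prop 3.1 (i) p.87] -/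
def thetaMonoidCollection : E.Iota → Submonoid E.H × Submonoid E.H :=
  fun ι => (E.thetaMonoid ι, E.inftyThetaMonoid ι)

/-- `Ψ_cns(M^Θ_*) := M_TM(M^Θ_*)`, the **constant monoid** ([IUTchII] Prop 3.1 (ii) p. 88, "naturally
isomorphic to `O^▷_{F̄_v}`"). [cite: Mochizuki2012, Prop 3.1 (ii) p.88] -/
def constantMonoid : Submonoid E.H := E.constants

/-- The conjugation action preserves a submonoid (the "natural conjugation action by
`Π_X(M^Θ_*)`" on the collections of Prop 3.1 (i)/(ii), pp. 87–88, is recorded through this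
predicate). [cite: Mochizuki2012, Prop 3.1 (i) p.87] -/
def IsConjStable (S : Submonoid E.H) : Prop := ∀ (g : P) (x : E.H), x ∈ S → E.conj g x ∈ S

end ThetaEnvData

/-- INTERFACE (Prop-valued, partly SLOT-ONLY): the statement-level content of [IUTchII] Prop 3.1
(i)–(ii) beyond the definitions above (pp. 87–88): functoriality of `M^Θ_* ↦ (data)` in the projective system of
mono-theta environments, the conjugation action on the collections `{Ψ^ι_env}_ι`, `{∞Ψ^ι_env}_ι`
(permuting the `ι`'s), the "splittings up to torsion", and "`Ψ_cns(M^Θ_*)` … naturally isomorphic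
to `O^▷_{F̄_v}`" via the cyclotomic rigidity isomorphisms of Cors 2.8 (i), 2.9 and "the inverse
image of `ℤ ⊆ Ẑ` via the surjection of Remark 1.11.5 (i)". Prop-valued, quoting print; not
asserted. [cite: Mochizuki2012, Prop 3.1 p.87] -/
structure Prop31Statements {P : Type u} [Group P] (E : ThetaEnvData.{u, v} P) : Prop where
  /-- (i) "this collection of subsets is equipped with a natural conjugation action by
  `Π_X(M^Θ_*)`": each `g` carries `Ψ^ι_env` onto some `Ψ^{ι'}_env` -/
  conj_permutes : ∀ (g : P) (ι : E.Iota), ∃ ι' : E.Iota,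
    (E.thetaMonoid ι).map (E.conj g).toMonoidHom = E.thetaMonoid ι'
  /-- (i) "splittings up to torsion determined by the subsets `M^×_TM`, `θ^ι_env`, `∞θ^ι_env`" -/
  splitting : ∀ ι : E.Iota, IsSplittingUpToTorsion E.units (Submonoid.closure (E.inftyThetaEnv ι))
  /-- (ii) `Ψ_cns(M^Θ_*)` is stable under the conjugation action -/
  constants_stable : E.IsConjStable E.constantMonoid

/-! ### 3. Example 3.2: theta monoids from tempered Frobenioids (pp. 88–89) -/

/-- INPUT DATA of Example 3.2 (pp. 88–89; [IUTchI] Ex 3.2): the group `O^×(T^÷_{A^Θ_∞})` of units of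
the birationalization at the universal covering pro-object `A^Θ_∞`, with the conjugation action of
`Π_v` (through `Π_v ↠ Aut_{D_v}(Ÿ_v)`), the unit subgroup `O^×_{C^Θ_v}(A^Θ_∞)`, the Frobenioid-theoretic
theta function `Θ_v|_{A^Θ_∞}`, and the monoid `Ψ_{C_v} := O^▷_{C_v}(A^Θ_∞)` of (ii).
-- TODO-merge: abc-iut-L5-t2 ([IUTchI] Ex 3.2 (i)–(vi)). [cite: Mochizuki2012, Ex 3.2 (i) p.88] -/
structure TemperedFrobenioidThetaData (P : Type u) [Group P] where
  /-- `O^×(T^÷_{A^Θ_∞})` (bundled `CommGrpCat`) -/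
  K : CommGrpCat.{v}
  /-- conjugation action of `Π_v` -/
  conj : P →* MulAut K
  /-- `O^×_{C^Θ_v}(A^Θ_∞)` -/
  units : Subgroup K
  /-- `Θ_v|_{A^Θ_∞}` -/
  theta : K
  /-- `Ψ_{C_v} = O^▷_{C_v}(A^Θ_∞) ⊆ O^×(T^÷_{A^Θ_∞})` (Ex 3.2 (ii) p. 89) -/
  baseMonoid : Submonoid K


namespace TemperedFrobenioidThetaData

variable {P : Type u} [Group P] (F : TemperedFrobenioidThetaData.{u, v} P)

/-- `Ψ_{F^Θ_v,α} := O^×_{C^Θ_v}(A^Θ_∞) · (Θ^α_v)^ℕ` for the conjugate `Θ^α_v` of `Θ_v` by `α ∈ Π_v`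
([IUTchII] Ex 3.2 (i) p. 88–89; `α = id` gives `Ψ_{F^Θ_v,id}`). [cite: Mochizuki2012, Ex 3.2 (i) p.88] -/
def frobThetaMonoid (α : P) : Submonoid F.K :=
  splitMonoid F.units (Submonoid.powers (F.conj α F.theta))

/-- `∞Ψ_{F^Θ_v,α} := O^×_{C^Θ_v}(A^Θ_∞) · (Θ^α_v)^{ℚ≥0}`, "where the superscript `ℚ≥0` denotes the set of
elements for which some [positive integer] power is equal to a [positive integer] power of"
`Θ^α_v` ([IUTchII] Ex 3.2 (i) p. 88) — the tree's `rootPowers` (both exponents positive;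
`BadPrimeGaussianMonoids`). [cite: Mochizuki2012, Ex 3.2 (i) p.88] -/
def inftyFrobThetaMonoid (α : P) : Submonoid F.K :=
  splitMonoid F.units (rootPowers (F.conj α F.theta))

/-- `Ψ_{F^Θ_v,α} ⊆ ∞Ψ_{F^Θ_v,α}` ([IUTchII] Ex 3.2 (i) p. 88). [cite: Mochizuki2012, Ex 3.2 (i) p.88] -/
theorem frobThetaMonoid_le_infty (α : P) : F.frobThetaMonoid α ≤ F.inftyFrobThetaMonoid α :=
  sup_le_sup_left (powers_le_rootPowers _) _

/-- `Ψ_{F^Θ_v} := {Ψ_{F^Θ_v,α}}_{α ∈ Π_v}`, `∞Ψ_{F^Θ_v} := {∞Ψ_{F^Θ_v,α}}_{α ∈ Π_v}` ([IUTchII] Ex 3.2 (i)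
p. 89). [cite: Mochizuki2012, Ex 3.2 (i) p.89] -/
def frobThetaCollection : P → Submonoid F.K × Submonoid F.K :=
  fun α => (F.frobThetaMonoid α, F.inftyFrobThetaMonoid α)

/-- The conjugation action permutes the collection: `β · Ψ_{F^Θ_v,α} = Ψ_{F^Θ_v,βα}` when the units are
conjugation-stable ("a natural conjugation action of `Π_v` on the collections of submonoids",
[IUTchII] Ex 3.2 (i) p. 89) — proved. [cite: Mochizuki2012, Ex 3.2 (i) p.89] -/
theorem frobThetaMonoid_conj (hU : ∀ (g : P) (x : F.K), x ∈ F.units → F.conj g x ∈ F.units)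
    (β α : P) :
    (F.frobThetaMonoid α).map (F.conj β).toMonoidHom = F.frobThetaMonoid (β * α) := by
  unfold frobThetaMonoid splitMonoid
  rw [Submonoid.map_sup, Submonoid.map_powers, map_mul]
  congr 1
  ext x
  simp only [Submonoid.mem_map, Subgroup.mem_toSubmonoid, MulEquiv.toMonoidHom_eq_coe,
    MonoidHom.coe_coe]
  constructor
  · rintro ⟨y, hy, rfl⟩; exact hU β y hy
  · intro hx
    refine ⟨(F.conj β).symm x, ?_, by simp⟩
    have := hU β⁻¹ x hx
    rwa [map_inv, MulAut.inv_def] at this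

end TemperedFrobenioidThetaData

/-- INTERFACE (Prop-valued over the real submonoids above): the remaining statement-level content
of [IUTchII] Example 3.2 (pp. 88–89):
"`Θ_v^{ℚ≥0}|_{A^Θ_∞}` determines characteristic splittings, up to torsion, of the monoids
`Ψ_{F^Θ_v,α}`, `∞Ψ_{F^Θ_v,α}` which are compatible with the action of `Π_v`", and the data
`Π_v ↷ Ψ_{F^Θ_v}, ∞Ψ_{F^Θ_v}` [resp. `Π_v ↷ Ψ_{C_v}`] "may be reconstructed category-theoretically from
`F_v` [cf. [IUTchI], Example 3.2, (vi), (e)] [resp. (iii), (vi)(d); [FrdI] Thm 3.4 (iv); [FrdII]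
Thm 1.2 (i), Ex 1.3 (i)], up to an indeterminacy arising from the inner automorphisms of `Π_v`".
Prop-valued, quoting print; not asserted. [cite: Mochizuki2012, Ex 3.2 p.88] -/
structure Example32Statements {P : Type u} [Group P] (F : TemperedFrobenioidThetaData.{u, v} P) :
    Prop where
  /-- (i) characteristic splittings up to torsion -/
  splitting : ∀ α : P, IsSplittingUpToTorsion F.units (rootPowers (F.conj α F.theta))
  /-- (i) units are conjugation-stable (so the collection carries the conjugation action) -/
  units_stable : ∀ (g : P) (x : F.K), x ∈ F.units → F.conj g x ∈ F.units
  /-- (ii) `Ψ_{C_v}` is conjugation-stable -/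
  base_stable : ∀ (g : P) (x : F.K), x ∈ F.baseMonoid → F.conj g x ∈ F.baseMonoid

/-! ### 4. Proposition 3.3: Kummer isomorphisms (pp. 89–90) -/

/-- INTERFACE, [IUTchII] Prop 3.3 (i)–(ii) pp. 89–90, for `M^Θ_* = M^Θ_*(†F_v)` arising from a tempered
Frobenioid in a Θ-Hodge theater: "for a suitable bijection of `l·ℤ`-torsors between
[`Gal(Ÿ_v/Y_v)`-orbits of] «`ι`» … and images of «`α`» via the natural surjection `Π_v ↠ l·ℤ`,
collections of isomorphisms of monoids `Ψ_{†F^Θ_v,α} ⥲ Ψ^ι_env(M^Θ_*)`; `∞Ψ_{†F^Θ_v,α} ⥲ ∞Ψ^ι_env(M^Θ_*)` —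
each of which is well-defined up to composition with an inner automorphism … and compatible with
both the respective conjugation actions by `Π_X(M^Θ_*)` and the splittings up to torsion", and (ii)
"an isomorphism of monoids `Ψ_{†C_v} ⥲ Ψ_cns(M^Θ_*)` … well-defined up to composition with an inner
automorphism". The isomorphisms are DATA here; their origin ("by forming Kummer classes") is the
TODO-merge ([FrdII] Def 2.1 (ii), Thm 2.4; Prop 1.3 (i)). [cite: Mochizuki2012, Prop 3.3 p.89] -/
structure Prop33KummerStatements {P : Type u} [Group P] (E : ThetaEnvData.{u, v} P)
    (F : TemperedFrobenioidThetaData.{u, v} P) where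
  /-- the "suitable bijection" matching conjugates `α` (through their image in `l·ℤ`) with the `ι`'s -/
  label : P → E.Iota
  /-- (i) `Ψ_{†F^Θ_v,α} ⥲ Ψ^ι_env(M^Θ_*)` -/
  kummerTheta : ∀ α : P, F.frobThetaMonoid α ≃* E.thetaMonoid (label α)
  /-- (i) `∞Ψ_{†F^Θ_v,α} ⥲ ∞Ψ^ι_env(M^Θ_*)` -/
  kummerInftyTheta : ∀ α : P, F.inftyFrobThetaMonoid α ≃* E.inftyThetaMonoid (label α)
  /-- (i) the two are compatible with the inclusions `Ψ ⊆ ∞Ψ` -/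
  kummer_compatible : ∀ (α : P) (x : F.frobThetaMonoid α),
    ((kummerInftyTheta α) ⟨x.1, F.frobThetaMonoid_le_infty α x.2⟩).1 =
      ((kummerTheta α) x).1
  /-- (ii) `Ψ_{†C_v} ⥲ Ψ_cns(M^Θ_*)` -/
  kummerConstant : F.baseMonoid ≃* E.constantMonoid
  /-- (i)/(ii) "compatible with the respective conjugation actions" and "well-defined up to
  composition with an inner automorphism" (quoted; over the suppressed topological data) -/
  equivariance : Prop

/-! ### 5. Proposition 3.4, Remark 3.4.1, Corollary 3.7, Remark 3.7.1: multi- and uni-radiality -/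

/-- INTERFACE, SLOT-ONLY (fields of type `Prop`, instantiable by `True`, not counted as typed
content): the radiality assertions of [IUTchII] §3 as named Prop slots over the radial environments
of Example 1.7 and the `Ism`/`×μ` formalism of Example 1.8 (iv) (owner abc-iut-L6-t1,
`RadialEnvironments` p404042), quoting print; none is asserted. -- TODO-merge: abc-iut-L6-t1 (Ex 1.7 (ii),
-- Ex 1.8 (iv), Cor 1.12 (iii), Rmk 1.11.3/1.11.5). [cite: Mochizuki2012, Prop 3.4 p.91] -/
structure RadialityStatements where
  /-- Prop 3.4 (i) p. 91–92 (multiradiality of split theta monoids): the functorial algorithms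
  `Π_v ↦ Ψ_env(M^Θ_*(Π_v))`, `Π_v ↦ ∞Ψ_env(M^Θ_*(Π_v))` "are compatible … with arbitrary automorphisms of
  the pair `G_v(M^Θ_*(†F_v)) ↷ (Ψ_{†F^Θ_v})^{×μ}` which arise as `Ism`-multiples of automorphisms induced
  by automorphisms of the pair `G_v(M^Θ_*(†F_v)) ↷ (Ψ_{†F^Θ_v})^×` … in the sense that the natural
  functor «`Ψ_R`» of Corollary 1.12, (iii), is multiradially defined". -/
  splitTheta_multiradial : Prop
  /-- Prop 3.4 (ii) p. 92–93 (uniradiality of constant monoids): `Π_v ↦ Ψ_cns(M^Θ_*(Π_v))` "depends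
  on the cyclotomic rigidity isomorphism of Corollary 1.11, (b) …, hence fails to be compatible …
  with automorphisms of the pair `G_v(M^Θ_*(†F_v)) ↷ (Ψ_{†C_v})^{×μ}` … in the sense that this
  algorithm, as given, only admits a uniradial formulation". -/
  constant_uniradial : Prop
  /-- Remark 3.4.1 (i) p. 93: the pairs above "correspond to the pair «`G ↷ O^{×μ}(G)`» … of
  Remark 1.11.3, (ii)"; the (multi/uni)radiality "may be thought of as a statement of the
  compatibility (respectively, incompatibility) of the algorithm in question with the
  «`O^{×μ}`-version» of the Θ-link of [IUTchI], Corollary 3.7, (iii)". -/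
  remark341_i : Prop
  /-- Remark 3.4.1 (ii) p. 93 / Remark 3.7.1 p. 112 (forward references to [IUTchIII]): "by
  applying the theory of log-shells [cf. [AbsTopIII]], one may construct certain algorithms
  related to the algorithm of Proposition 3.4, (ii) [resp. modify the algorithms of Corollary
  3.7, (ii)], that [yield functors which] are manifestly multiradially defined — albeit at the
  cost of allowing for certain [relatively mild!] indeterminacies". Typed in [IUTchIII] by
  abc-iut-L6-t3/t4; recorded here as a slot. -/
  logShell_multiradial : Prop
  /-- Cor 3.7 (i) p. 111 (from group-theoretic to post-anabelian Gaussian monoids): each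
  isomorphism `M^Θ_*(Π_v) ⥲ M^Θ_*(†F_v)` "induces compatible collections of isomorphisms"
  `Ψ_env/∞Ψ_env(M^Θ_*(Π_v)) ⥲ Ψ_ξ/∞Ψ_ξ(M^Θ_*(Π_v)) ⥲ … ⥲ Ψ_ξ(M^Θ_*(†F_v)) ⥲ Ψ_{F_ξ}(†F_v)` and, on units,
  `Ψ^ι_env(…)^× ⥲ Ψ_ξ(…)^× ⥲ … ⥲ Ψ_{F_ξ}(†F_v)^×` over `G_v(Π_{v▶}) ⥲ G_v(Π_{v▶})_{⟨F_l^⋇⟩} ⥲ …`. -/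
  cor37_i : Prop
  /-- Cor 3.7 (ii) p. 112 (uniradiality of Gaussian monoids): `Π_v ↦ Ψ_gau(M^Θ_*(Π_v))`,
  `∞Ψ_gau(M^Θ_*(Π_v))` "depend on the cyclotomic rigidity isomorphism of Corollary 1.11, (b) …, hence
  fail to be compatible … with automorphisms of the pair `G_v(M^Θ_*(†F_v))_{⟨F_l^⋇⟩} ↷ Ψ_{F_ξ}(†F_v)^{×μ}`
  … only admits a uniradial formulation". -/
  gaussian_uniradial : Prop

/-! ### 6. Definition 3.8: the associated Frobenioids (pp. 112–115) -/

/-- INTERFACE, SLOT-ONLY naming record ([IUTchII] Definition 3.8 (i)–(iii) pp. 112–115): the Frobenioids attached ("via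
[FrdII], Example 1.1, (ii)") to the monoids-with-Galois-action of §3, as a record of NAMED objects
of an abstract type `Frob` of Frobenioids with an abstract isomorphism relation, one field per
printed object/isomorphism. Owners of the Frobenioid formalism: abc-iut-L1-* ([FrdI], [FrdII]);
`M^Θ_*`, `†F_v`, value-profiles `ξ` as in Props 3.1, 3.3, Cor 3.5.
-- TODO-merge: abc-iut-L1-t4 ([FrdII] Ex 1.1 (ii)), abc-iut-L5-t2 ([IUTchI] Ex 3.2 (iii)–(v)).
[cite: Mochizuki2012, Def 3.8 p.112] -/
structure Def38Frobenioids (Frob : Type u) (Iso : Frob → Frob → Prop) (Iota Conj ValueProfile Label : Type v)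
    where
  /-- (i) `F_cns(M^Θ_*)`: "a `p_v`-adic Frobenioid of monoid type `ℤ` … whose divisor monoid associates to
  every object of `B^temp(Π_X(M^Θ_*))^0` a monoid isomorphic to `ℚ_{≥0}`" -/
  Fcns : Frob
  /-- (i) `F_{†C_v}`, with "a tautological isomorphism of Frobenioids `†C_v ⥲ F_{†C_v}`" used to identify -/
  FdagC : Frob
  /-- (i) "the isomorphism of monoids of Proposition 3.3, (ii), may be interpreted as an isomorphism
  of Frobenioids `†C_v ⥲ F_cns(M^Θ_*)`" -/
  kummerConstant : Iso FdagC Fcns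
  /-- (i) the mono-analytic versions `†C^⊢_v ⥲ F^⊢_cns(M^Θ_*)` and their labeled versions
  `(†C^⊢_v)_{|t|} ⥲ (F^⊢_cns(M^Θ_*))_{|t|}` -/
  FcnsMono : Frob
  /-- (i) `†C^⊢_v` -/
  FdagCMono : Frob
  /-- (i) `†C^⊢_v ⥲ F^⊢_cns(M^Θ_*)` -/
  kummerConstantMono : Iso FdagCMono FcnsMono
  /-- (ii) `F^ι_env(M^Θ_*)`: "`p_v`-adic Frobenioid of monoid type `ℤ` … divisor monoid … isomorphic to
  `ℕ`", from `G_v(M^Θ_*▶) ↷ Ψ^ι_env(M^Θ_*)`, "equipped with a collection of splittings" -/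
  Fenv : Iota → Frob
  /-- (ii) `F_{†F^Θ_v,α}` from `G_v(M^Θ_*▶) ↷ Ψ_{†F^Θ_v,α}`, identified with `†C^Θ_v` by "a tautological
  isomorphism of Frobenioids `†C^Θ_v ⥲ F_{†F^Θ_v,α}` … compatible with the associated splittings" -/
  FdagTheta : Conj → Frob
  /-- (ii) `F_ξ(M^Θ_*)` from `G_v(M^Θ_*▶)_{⟨F_l^⋇⟩} ↷ Ψ_ξ(M^Θ_*)` -/
  Fgau : ValueProfile → Frob
  /-- (ii) `F_{F_ξ}(†F_v)` from `G_v(M^Θ_*)_{⟨F_l^⋇⟩} ↷ Ψ_{F_ξ}(†F_v)` -/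
  FFgau : ValueProfile → Frob
  /-- the "suitable bijection" matching conjugates `α` with inversion automorphisms `ι` (Prop 3.3 (i)) -/
  label : Conj → Iota
  /-- (ii) "isomorphisms of split Frobenioids `F_{†F^Θ_v,α} ⥲ F^ι_env(M^Θ_*)`" (Prop 3.3 (i)) -/
  evalIsoThetaEnv : ∀ α : Conj, Iso (FdagTheta α) (Fenv (label α))
  /-- (ii) "`F^ι_env(M^Θ_*) ⥲ F_ξ(M^Θ_*)`" (Cor 3.5 (iii)), "compatible with the subcategories `F_{2l·ξ} ⊆ F_ξ`" -/
  evalIsoEnvGau : ∀ (ι : Iota) (ξ : ValueProfile), Iso (Fenv ι) (Fgau ξ)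
  /-- (ii) "`F_ξ(M^Θ_*) ⥲ F_{F_ξ}(†F_v)`" (Cor 3.6 (iii)) -/
  evalIsoGauF : ∀ ξ : ValueProfile, Iso (Fgau ξ) (FFgau ξ)
  /-- (iii) the "natural embeddings of categories" `F_ξ(M^Θ_*) ↪ ∏_{|t| ∈ F_l^⋇} F^⊢_cns(M^Θ_*)_{|t|}`,
  `F_{F_ξ}(†F_v) ↪ ∏_{|t|} (†C^⊢_v)_{|t|}` ("Gaussian distributions"), which "coincide on the subcategories
  `F_{2l·ξ}`", and the diagonal "constant distributions"
  `F^⊢_cns ⥲ F^⊢_cns,⟨F_l^⋇⟩ ↪ F^⊢_cns,F_l^⋇ := ∏_{|t|} F^⊢_cns,|t|` -/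
  gaussianDistribution : ValueProfile → Label → Frob
  /-- (iii) the constant distribution, label by label -/
  constantDistribution : Label → Frob
  /-- (iii) each labeled factor of the constant distribution is (isomorphic to) `F^⊢_cns` -/
  constantDistribution_iso : ∀ t : Label, Iso (constantDistribution t) FcnsMono

/-! Remark 3.8.1 p. 115 (design note, no declaration): "an «isomorphism of categories» is to be
understood as an isomorphism class of equivalences of categories"; for a precise Frobenioid-theoretic
translation of conjugate synchronization "one is obliged to consider the various Frobenioids indexed by
a subscript `|t| ∈ |F_l|` as being determined up to an isomorphism of the identity functor … which is
independent of `|t| ∈ |F_l|`" — whence "the simplest approach is to resort to the original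
monoid-theoretic formulations". This file follows that advice: the monoid-theoretic objects are
primary and `Def38Frobenioids` is a naming record. [cite: Mochizuki2012, Rmk 3.8.1 p.115] -/

end TemperedThetaMonoids

end Literature.IUT.HodgeArakelov
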